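import Summits.BirchSwinnertonDyer.Rank1Residual.X1.GeneratorCountSqueeze
import Literature.NumberTheory.EllipticCurves.Greenberg1999.NoProperFiniteIndexSubmoduleOrdinary
import HarnessLib

/-!
# Route M in the kernel, all inputs named: the no-finite-submodule input discharged BY NAME from
# Greenberg 1999 Prop. 4.15 (ii) at every good ordinary `p ≥ 3`

HONEST FRAMING (cell `b2b-bsdres`, run/shared/lean/b2b/bsd-rank1-residual/, verbatim in every
file): the goal of the cell is to DELETE the COMBINATION-SHAPED residual classes of the
Birch–Swinnerton-Dyer formula for ALL analytic-rank `≤ 1` elliptic curves over `ℚ` — "full BSD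
formula for every rank `≤ 1` curve in class `C`" assembled STRICTLY from published theorems — so
that the rank-`≤ 1` remainder becomes exactly the CONSTRUCTION-SHAPED classes, which are TYPED
(missing-input `Prop`s), NOT attempted. This is not "finishing BSD". Sub-cell
`b2b-bsdres-eisenstein-p1` (CLASS-OWNERS row "X1 (r=0)"), gen 13: research route; NO CLAIM BEYOND
STATED CLASSES; nothing here changes a label. THEOREMS ONLY; no definition, no new fact.

`X1/GeneratorCountSqueeze.lean` derives `λ_alg ∈ {d | ∃ v ≥ B, (d,v) ∈ S}` and `BSD(E,p)` on the
leaf from the typed generator COUNT `GeneratorCountGE W p B`, the typed Newton data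
`AnalyticLamConstValDivisorSet W p S`, LEMMA M₀ (`X1/GeneratorBound.lean`) and the typed input
`NoFiniteSubmoduleAt p W` ("`X(E/ℚ_∞)` has no nonzero finite `Λ`-submodule"). On the leaf (good
ordinary anomalous `p ≥ 3`) that last input is Greenberg 1999 Prop. 4.15 (ii) (`F = ℚ`, `v₀ = p`,
`e = 1 ≤ p − 2`), vendored as the named fact
`Greenberg1999.prop415ii_noFiniteSubmodule_of_ordinary_or_multiplicative` (gen 13): this file
discharges it BY NAME (`noFiniteSubmoduleAt_of_prop415ii`) and records the headline with NO typed
no-finite-submodule input left (`Leaf.bsdp_of_muZero_of_generatorCount_of_prop415`): per pair the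
inputs are the two certificates `B`, `S`, the analytic `μ_an = 0`, `λ_an = n`, and the PUBLISHED
facts `hW16` (Wuthrich Thm. 16), `hGr` (Greenberg Thm. 4.1), `h310` (Prop. 3.10), `h415`
(Prop. 4.15 (ii)), `hmod` (modularity), `hGZK` (Gross–Zagier–Kolyvagin). Census (X1R0-GAPMAP §22.3):
the closing member has a rational `p`-torsion point (so Prop. 4.14 does not apply, Prop. 4.15 (ii)
does) in 272 of the 421 kernel-form closures.

References: [GreenbergLNM1716] Prop. 3.10, Thm. 4.1, Prop. 4.15 (ii), p. 137; [Wuthrich2014] Thm. 16;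
X1R0-GAPMAP §22.
-/

noncomputable section

open scoped Classical MatrixGroups ModularForm

open PowerSeries CongruenceSubgroup WeierstrassCurve Literature.NumberTheory.EllipticCurves
  Literature.NumberTheory.EllipticCurves.ModularForms
  Literature.NumberTheory.EllipticCurves.Rank1Residual
  Literature.NumberTheory.EllipticCurves.Greenberg1999
  Summit.BirchSwinnertonDyer.BirchSwinnertonDyer.Theorems.Rank1ResidualX1Defs
  Summit.BirchSwinnertonDyer.Rank1Residual.X1.MuLambda
  Summit.BirchSwinnertonDyer.Rank1Residual.X1.MuPart
  Summit.BirchSwinnertonDyer.Rank1Residual.X1.ParitySqueeze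
  Summit.BirchSwinnertonDyer.Rank1Residual.X1.GeneratorSqueeze
  Summit.BirchSwinnertonDyer.Rank1Residual.X1.GeneratorCountSqueeze
  Summit.BirchSwinnertonDyer.Rank1Residual.Additive

set_option autoImplicit false

namespace Summit.BirchSwinnertonDyer.Rank1Residual.X1.GeneratorCountSqueezeFacts

variable {W : WeierstrassCurve ℚ} [W.IsElliptic] [W.IsGloballyMinimal] {p : ℕ} [Fact p.Prime]

/-- **`NoFiniteSubmoduleAt p W` BY NAME from Greenberg 1999 Prop. 4.15 (ii)** at a good ordinary
prime `p ≥ 3` (`F = ℚ`, `v₀ = p`, `e_{v₀} = 1 ≤ p − 2`): for every cyclotomic dual datum with `X`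
finitely generated torsion, every finite `Λ`-submodule of `X(E/ℚ_∞)` is `0` — with NO hypothesis on
`E(ℚ)_tors` (contrast Prop. 4.14). [cite: GreenbergLNM1716, Prop. 4.15 (ii) (§4; held copy chunk p0125 L22–28)] -/
theorem noFiniteSubmoduleAt_of_prop415ii
    (h415 : prop415ii_noFiniteSubmodule_of_ordinary_or_multiplicative) (hp : 3 ≤ p)
    (hgood : W.HasGoodReductionAtPrime p) (hord : ¬ (p : ℤ) ∣ W.frobeniusTrace p) :
    NoFiniteSubmoduleAt p W :=
  fun hκ hγ _ D _ hXt N hN ↦ h415 W p hp (Or.inl ⟨hgood, hord⟩) _ _ hκ hγ D hXt N hN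

/-- **ROUTE M IN THE KERNEL, ALL ARITHMETIC INPUTS NAMED: on the leaf X1 ∩ {r = 0},
`μ_an = 0 ∧ λ_an = n ∧ (count B) ∧ (Newton data S) ∧ gap ⇒ BSD(E,p)`.** Typed per-pair inputs:
`AnalyticMuLE W p 0`, `AnalyticLambdaEq W p n`, `GeneratorCountGE W p B` (route T's §14.1 count),
`AnalyticLamConstValDivisorSet W p S` (Newton polygon of `ϖ·L_p`); gap check
`∀ (d,v) ∈ S, B ≤ v → Even d → d ≤ n → n ≤ d + 1`. Named PUBLISHED facts: Wuthrich 2014 Thm. 16,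
Greenberg 1999 Thm. 4.1 / Prop. 3.10 / Prop. 4.15 (ii), modularity, Gross–Zagier–Kolyvagin. The
leaf supplies `p ≥ 3` and good ordinary reduction for Prop. 4.15 (ii). EXAMPLE `258f1@7` (rational
`7`-torsion, so Prop. 4.14 is silent): `n = 6`, `B = 2`, `S = {(0,0),(2,1),(4,1),(6,2)}`.
[cite: GreenbergLNM1716, Prop. 3.10, Thm. 4.1, Prop. 4.15 (ii), §4 Lemma 4.2, p. 137]
[cite: Wuthrich2014, Thm. 16 (p. 397)] -/
theorem Leaf.bsdp_of_muZero_of_generatorCount_of_prop415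
    (hW16 : Wuthrich2014.charIdeal_dvd_padicLFunction) (hGr : greenberg_charValue_rankZero)
    (h310 : prop310_selmerCorank_mod_two_eq_lambdaInvariant)
    (h415 : prop415ii_noFiniteSubmodule_of_ordinary_or_multiplicative)
    (hmod : nonempty_modularParametrizationData)
    (hGZK : rank_eq_analyticRank_of_analyticRank_le_one) (hL : RankZero.Leaf W p)
    (hμ0 : AnalyticMuLE W p 0) {n B : ℕ} {S : Set (ℕ × ℕ)}
    (hlam : AnalyticLambdaEq W p n) (hB : GeneratorCountGE W p B)
    (hS : AnalyticLamConstValDivisorSet W p S)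
    (hgap : ∀ d v, (d, v) ∈ S → B ≤ v → Even d → d ≤ n → n ≤ d + 1) : BSDp W p :=
  have hX := isClassX1_of_classX1 hL.classX1
  Leaf.bsdp_of_muZero_of_generatorCount hW16 hGr h310 hmod hGZK hL
    (noFiniteSubmoduleAt_of_prop415ii h415 (lt_of_le_of_ne (Nat.Prime.two_le Fact.out) (Ne.symm hX.two_ne))
      hX.hasGoodReductionAtPrime hX.not_dvd_frobeniusTrace) hμ0 hlam hB hS hgap

/-- **The intersected form with all inputs named** (M₀ ∘ C, M₀ ∧ T): the count certificate meets any
other membership certificate `AlgebraicLambdaMem W p A'`. [cite: GreenbergLNM1716, Prop. 3.10,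
Thm. 4.1, Prop. 4.15 (ii), pp. 132, 137] [cite: Wuthrich2014, Thm. 16 (p. 397)] -/
theorem Leaf.bsdp_of_muZero_of_generatorCount_inter_of_prop415
    (hW16 : Wuthrich2014.charIdeal_dvd_padicLFunction) (hGr : greenberg_charValue_rankZero)
    (h310 : prop310_selmerCorank_mod_two_eq_lambdaInvariant)
    (h415 : prop415ii_noFiniteSubmodule_of_ordinary_or_multiplicative)
    (hmod : nonempty_modularParametrizationData)
    (hGZK : rank_eq_analyticRank_of_analyticRank_le_one) (hL : RankZero.Leaf W p)
    (hμ0 : AnalyticMuLE W p 0) {n B : ℕ} {S : Set (ℕ × ℕ)} {A' : Set ℕ}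
    (hlam : AnalyticLambdaEq W p n) (hB : GeneratorCountGE W p B)
    (hS : AnalyticLamConstValDivisorSet W p S) (hA' : AlgebraicLambdaMem W p A')
    (hgap : ∀ d v, (d, v) ∈ S → B ≤ v → d ∈ A' → Even d → d ≤ n → n ≤ d + 1) : BSDp W p :=
  have hX := isClassX1_of_classX1 hL.classX1
  Leaf.bsdp_of_muZero_of_generatorCount_inter hW16 hGr h310 hmod hGZK hL
    (noFiniteSubmoduleAt_of_prop415ii h415 (lt_of_le_of_ne (Nat.Prime.two_le Fact.out) (Ne.symm hX.two_ne))
      hX.hasGoodReductionAtPrime hX.not_dvd_frobeniusTrace) hμ0 hlam hB hS hA' hgap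

/-- **At a member of any μ (the 101 closing members with `μ_an ≥ 1` of the census): `MuPartAt ∧
λ_an = n ∧ (count B) ∧ (Newton data S) ∧ gap ⇒ BSD(E,p)`** on the leaf, all other arithmetic inputs
named (`MuPartAt W p` from route P's per-member data, e.g. `MuPart.Leaf.muPartAt_of_ramified_cyclic_of_analyticMuLE`
at a member of ramified cyclic depth `m` with `μ_an ≤ m`). [cite: GreenbergLNM1716, Prop. 3.10,
Thm. 4.1, Prop. 4.15 (ii), p. 137] [cite: Wuthrich2014, Thm. 16 (p. 397)] -/
theorem Leaf.bsdp_of_muPartAt_of_generatorCount_of_prop415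
    (hW16 : Wuthrich2014.charIdeal_dvd_padicLFunction) (hGr : greenberg_charValue_rankZero)
    (h310 : prop310_selmerCorank_mod_two_eq_lambdaInvariant)
    (h415 : prop415ii_noFiniteSubmodule_of_ordinary_or_multiplicative)
    (hmod : nonempty_modularParametrizationData)
    (hGZK : rank_eq_analyticRank_of_analyticRank_le_one) (hL : RankZero.Leaf W p)
    (hμ : MuPartAt W p) {n B : ℕ} {S : Set (ℕ × ℕ)}
    (hlam : AnalyticLambdaEq W p n) (hB : GeneratorCountGE W p B)
    (hS : AnalyticLamConstValDivisorSet W p S)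
    (hgap : ∀ d v, (d, v) ∈ S → B ≤ v → Even d → d ≤ n → n ≤ d + 1) : BSDp W p :=
  have hX := isClassX1_of_classX1 hL.classX1
  GeneratorSqueeze.Leaf.bsdp_of_lambdaMem hW16 hGr h310 hmod hGZK hL hμ hlam
    (AlgebraicLambdaMem.of_generatorCount hW16 hmod hX.two_ne hX.hasGoodReductionAtPrime
      hX.not_dvd_frobeniusTrace hX.not_hasIrreducibleModPGaloisRep
      (entireLFunction_one_ne_zero_of_analyticRank_eq_zero hmod W hL.analyticRank_eq_zero)
      (noFiniteSubmoduleAt_of_prop415ii h415 (lt_of_le_of_ne (Nat.Prime.two_le Fact.out)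
        (Ne.symm hX.two_ne)) hX.hasGoodReductionAtPrime hX.not_dvd_frobeniusTrace) hB hS)
    fun d ⟨v, hv, hBv⟩ ↦ hgap d v hv hBv

/-- **Consistency (the kernel form of the census's 0-violations test):** on the leaf, a count
certificate `B` and a Newton certificate `S` always leave SOME `(d, v) ∈ S` with `B ≤ v` and
`d ≤ λ_an` — namely `(λ(f_E), v_p(f_E(0)))`; a pair `(B, S)` violating this would contradict
Kato–Wuthrich + Greenberg Prop. 4.15 (ii) + LEMMA M₀. [cite: GreenbergLNM1716, Prop. 4.15 (ii), p. 137]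
[cite: Wuthrich2014, Thm. 16 (p. 397)] -/
theorem Leaf.exists_mem_of_generatorCount
    (hW16 : Wuthrich2014.charIdeal_dvd_padicLFunction)
    (h415 : prop415ii_noFiniteSubmodule_of_ordinary_or_multiplicative)
    (hmod : nonempty_modularParametrizationData) (hL : RankZero.Leaf W p) {n B : ℕ}
    {S : Set (ℕ × ℕ)} (hB : GeneratorCountGE W p B) (hS : AnalyticLamConstValDivisorSet W p S)
    (hn : AnalyticLambdaEq W p n) : ∃ d v, (d, v) ∈ S ∧ B ≤ v ∧ d ≤ n := by
  have hX := isClassX1_of_classX1 hL.classX1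
  obtain ⟨d, ⟨v, hv, hBv⟩, hdn⟩ := GeneratorSqueeze.Leaf.exists_mem_of_lambdaMem hW16 hmod hL
    (AlgebraicLambdaMem.of_generatorCount hW16 hmod hX.two_ne hX.hasGoodReductionAtPrime
      hX.not_dvd_frobeniusTrace hX.not_hasIrreducibleModPGaloisRep
      (entireLFunction_one_ne_zero_of_analyticRank_eq_zero hmod W hL.analyticRank_eq_zero)
      (noFiniteSubmoduleAt_of_prop415ii h415 (lt_of_le_of_ne (Nat.Prime.two_le Fact.out)
        (Ne.symm hX.two_ne)) hX.hasGoodReductionAtPrime hX.not_dvd_frobeniusTrace) hB hS) hn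
  exact ⟨d, v, hv, hBv, hdn⟩

end Summit.BirchSwinnertonDyer.Rank1Residual.X1.GeneratorCountSqueezeFacts

end
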